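import Literature.NumberTheory.ConnesMoscovici2022.UVProlateEigenfunctionEndpoint
import Mathlib.Analysis.Calculus.Deriv.Star
import HarnessLib

/-!
# Connes–Moscovici 2022, §2: even eigenfunctions of `W_sa` with negative eigenvalue vanish on `(−λ, λ)`

Topic `Literature/NumberTheory/ConnesMoscovici2022`.  For EVERY `λ > 0` (seat cc-t9's
`cutoffProj_eq_zero_of_hasEigenvector` is the case `λ = 1`, through the completeness of the prolate
functions): if `φ` is an a.e.-even eigenvector of `W_sa` with eigenvalue `μ < 0`, then `P_λ φ = 0`.
ROAD (energy identity, no spectral input): for the boundary-condition representative `g`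
(`UVProlateEigenfunctionEndpoint.lean`: smooth off `±λ`, `(p g′)′ = (q − μ) g`, one-sided limit at `λ⁻`),
`d/dx (p g′ · ḡ) = (q − μ)|g|² + p|g′|²` on `(−λ, λ)`, so for `a < λ`
`∫_{−a}^{a} ((q − μ)|g|² + p|g′|²) = 2 (p g′ ḡ)(a)` (evenness), which tends to `0` as `a → λ⁻` by the
boundary condition (1.19) and the boundedness of `g` at `λ⁻`; since the integrand dominates `−μ|g|² ≥ 0`,
`g ≡ 0` on `(−λ, λ)`.  This is the interior half of [ConnesMoscovici2022, Cor 2.2] ("`φ_μ` is zero inside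
`[−λ, λ]`", arXiv:2112.05500 §3 ¶ before Lemma 3.1) for general `λ`, and the positivity of
`P_λ W_sa` used in [ConnesMoscovici2022, Thm 5.1].  RH-FREE; nothing here bears on the truth of RH.
-/

noncomputable section

open Complex Set MeasureTheory Filter Topology intervalIntegral
open scoped Real Topology ContDiff ComplexConjugate

namespace Literature.NumberTheory.ConnesMoscovici2022

open Literature.NumberTheory.ConnesConsani2021 Literature.NumberTheory.ConnesConsani2024

variable {lam : ℝ}

/-- `S = ℝ ∖ {±λ}` is open (plumbing). [folklore] -/
private theorem isOpen_S' (lam : ℝ) : IsOpen {x : ℝ | x ≠ lam ∧ x ≠ -lam} := isOpen_ne.and isOpen_ne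

/-- An a.e.-even function continuous off `±λ` is even off `±λ` (plumbing). [folklore] -/
private theorem even_of_ae {g : ℝ → ℂ} (hgc : ContinuousOn g {x | x ≠ lam ∧ x ≠ -lam})
    (hae : ∀ᵐ x : ℝ, g (-x) = g x) : EqOn (fun x => g (-x)) g {x | x ≠ lam ∧ x ≠ -lam} := by
  refine Measure.eqOn_open_of_ae_eq (ae_restrict_of_ae hae) (isOpen_S' lam) ?_ hgc
  refine hgc.comp continuous_neg.continuousOn fun x hx => ?_
  simp only [mem_setOf_eq] at hx ⊢
  exact ⟨fun h => hx.2 (by linarith), fun h => hx.1 (by linarith)⟩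

/-- **The energy identity on `[−a, a] ⊂ (−λ, λ)`** for a function `g` smooth off `±λ` with
`(p g′)′ = (q − μ) g`: `∫_{−a}^{a} ((q − μ)|g|² + p|g′|²) = (p g′ ḡ)(a) − (p g′ ḡ)(−a)`.
[cite: ConnesMoscovici2022, §1 eqs. (1.5)–(1.7) (Lagrange identity / Green's formula; = arXiv:2112.05500 (2.5)–(2.7), chunk p0005:L24–L40)] -/
theorem energy_identity (lam μ : ℝ) {g : ℝ → ℂ}
    (hsm : ContDiffOn ℝ ∞ g {x | x ≠ lam ∧ x ≠ -lam})
    (hu : ∀ x ∈ {x : ℝ | x ≠ lam ∧ x ≠ -lam},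
      HasDerivAt (fun y => pCoeff lam y * deriv g y) ((qCoeff lam x - μ) * g x) x)
    {a : ℝ} (ha0 : 0 ≤ a) (ha : a < lam) :
    ∫ x in (-a)..a, (((2 * π * lam * x) ^ 2 - μ) * ‖g x‖ ^ 2 + (lam ^ 2 - x ^ 2) * ‖deriv g x‖ ^ 2) =
      (pCoeff lam a * deriv g a * conj (g a) - pCoeff lam (-a) * deriv g (-a) * conj (g (-a))).re := by
  have hS := isOpen_S' lam
  have hsub : uIcc (-a) a ⊆ {x : ℝ | x ≠ lam ∧ x ≠ -lam} := by
    rw [uIcc_of_le (by linarith)]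
    exact fun x hx => ⟨by intro h; rw [h] at hx; linarith [hx.2], by intro h; rw [h] at hx; linarith [hx.1]⟩
  have hgd : ∀ x ∈ {x : ℝ | x ≠ lam ∧ x ≠ -lam}, HasDerivAt g (deriv g x) x := fun x hx =>
    ((hsm.differentiableOn (by simp) x hx).differentiableAt (hS.mem_nhds hx)).hasDerivAt
  have hd1 : ContDiffOn ℝ 1 (deriv g) {x : ℝ | x ≠ lam ∧ x ≠ -lam} :=
    hsm.deriv_of_isOpen hS (by norm_cast)
  -- derivative of  u · conj g
  have hderiv : ∀ x ∈ uIcc (-a) a, HasDerivAt (fun y => pCoeff lam y * deriv g y * conj (g y))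
      ((((2 * π * lam * x) ^ 2 - μ) * ‖g x‖ ^ 2 + (lam ^ 2 - x ^ 2) * ‖deriv g x‖ ^ 2 : ℝ) : ℂ) x := by
    intro x hx
    have hxS := hsub hx
    have h := (hu x hxS).mul (hgd x hxS).star
    refine h.congr_deriv ?_
    simp only [star_def]
    rw [qCoeff, pCoeff]
    push_cast
    have h1 : g x * conj (g x) = (‖g x‖ : ℂ) ^ 2 := by
      rw [Complex.mul_conj, Complex.normSq_eq_norm_sq]; push_cast; ring
    have h2 : deriv g x * conj (deriv g x) = (‖deriv g x‖ : ℂ) ^ 2 := by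
      rw [Complex.mul_conj, Complex.normSq_eq_norm_sq]; push_cast; ring
    linear_combination ((2 * (π : ℂ) * lam) ^ 2 * (x : ℂ) ^ 2 - μ) * h1 + ((lam : ℂ) ^ 2 - (x : ℂ) ^ 2) * h2
  have hcont : ContinuousOn (fun x : ℝ =>
      ((((2 * π * lam * x) ^ 2 - μ) * ‖g x‖ ^ 2 + (lam ^ 2 - x ^ 2) * ‖deriv g x‖ ^ 2 : ℝ) : ℂ))
      (uIcc (-a) a) := by
    refine Complex.continuous_ofReal.comp_continuousOn ?_
    have hgc := (hsm.continuousOn.mono hsub)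
    have hg'c := (hd1.continuousOn.mono hsub)
    exact ((by fun_prop : Continuous fun x : ℝ => (2 * π * lam * x) ^ 2 - μ).continuousOn.mul
      (hgc.norm.pow 2)).add ((by fun_prop : Continuous fun x : ℝ => lam ^ 2 - x ^ 2).continuousOn.mul
      (hg'c.norm.pow 2))
  have hFTC := integral_eq_sub_of_hasDerivAt hderiv hcont.intervalIntegrable
  rw [intervalIntegral.integral_ofReal] at hFTC
  have := congrArg Complex.re hFTC
  rw [Complex.ofReal_re] at this
  rw [this]

/-- **Even eigenfunctions of `W_sa` with negative eigenvalue vanish on `(−λ, λ)`** (every `λ > 0`): for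
the boundary-condition representative `g` of `UVProlateEigenfunctionEndpoint.CM22_cor_1_7_i`.
[cite: ConnesMoscovici2022, Cor 2.2 and §2 ¶ before Lemma 2.1 (= arXiv:2112.05500 Cor 3.2, §3, chunk p0008:L79–L84)] -/
theorem repr_eq_zero_on_Ioo_of_neg (lam : ℝ) (hlam : 0 < lam) {W : L2R →ₗ.[ℂ] L2R}
    (hSA : IsProlateSA lam W) {μ : ℝ} (hμ : μ < 0) {φ : L2R} (hev : W.HasEigenvector (μ : ℂ) φ)
    (heven : ∀ᵐ x : ℝ, (φ : ℝ → ℂ) (-x) = (φ : ℝ → ℂ) x) :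
    ∃ g : ℝ → ℂ, (φ : ℝ → ℂ) =ᵐ[volume] g ∧ ProlateBC lam g ∧
      ContDiffOn ℝ (⊤ : ℕ∞) g {x | x ≠ lam ∧ x ≠ -lam} ∧ ∀ x ∈ Ioo (-lam) lam, g x = 0 := by
  obtain ⟨g, hfg, ⟨ε, hε, -, -, -, cL, hcL⟩, hbc, hsm⟩ := CM22_cor_1_7_i lam hlam W hSA μ φ hev
  obtain ⟨hφ, hW, -⟩ := exists_repr_of_hasEigenvector hSA hev
  have hS := isOpen_S' lam
  have hu : ∀ x ∈ {x : ℝ | x ≠ lam ∧ x ≠ -lam},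
      HasDerivAt (fun y => pCoeff lam y * deriv g y) ((qCoeff lam x - μ) * g x) x :=
    fun x hx => hasDerivAt_pCoeff_mul_deriv_repr hlam hφ hW hfg hbc.differentiableOn hx.1 hx.2
  have hgd : ∀ x ∈ {x : ℝ | x ≠ lam ∧ x ≠ -lam}, HasDerivAt g (deriv g x) x := fun x hx =>
    ((hsm.differentiableOn (by simp) x hx).differentiableAt (hS.mem_nhds hx)).hasDerivAt
  -- evenness of g off ±λ, and oddness of g′
  have hae : ∀ᵐ x : ℝ, g (-x) = g x := by
    have h1 : (fun x => (φ : ℝ → ℂ) (-x)) =ᵐ[volume] fun x => g (-x) :=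
      (Measure.measurePreserving_neg (volume : Measure ℝ)).quasiMeasurePreserving.ae_eq_comp hfg
    filter_upwards [heven, hfg, h1] with x h0 h2 h3
    rw [← h3, h0, h2]
  have hevenS : EqOn (fun x => g (-x)) g {x | x ≠ lam ∧ x ≠ -lam} := even_of_ae hsm.continuousOn hae
  have hderiv_odd : ∀ x ∈ {x : ℝ | x ≠ lam ∧ x ≠ -lam}, deriv g (-x) = -deriv g x := by
    intro x hx
    have hnx : -x ∈ {x : ℝ | x ≠ lam ∧ x ≠ -lam} :=
      ⟨fun h => hx.2 (by linarith), fun h => hx.1 (by linarith)⟩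
    -- g = g ∘ neg near x, so g′(x) = −g′(−x)
    have hloc : g =ᶠ[𝓝 x] fun y => g (-y) := by
      filter_upwards [hS.mem_nhds hx] with y hy
      exact (hevenS hy).symm
    have h1 : HasDerivAt (fun y => g (-y)) (-deriv g (-x)) x := by
      have h := (hgd (-x) hnx).scomp x (hasDerivAt_neg x)
      rw [show (g ∘ fun y : ℝ => -y) = fun y => g (-y) from rfl] at h
      exact h.congr_deriv (by simp)
    have h2 : deriv g x = -deriv g (-x) := by
      rw [hloc.deriv_eq]; exact h1.deriv
    rw [h2, neg_neg]
  -- the integrand and its lower bound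
  set F : ℝ → ℝ := fun x => ((2 * π * lam * x) ^ 2 - μ) * ‖g x‖ ^ 2 + (lam ^ 2 - x ^ 2) * ‖deriv g x‖ ^ 2
    with hF
  have hFge : ∀ x ∈ Ioo (-lam) lam, (-μ) * ‖g x‖ ^ 2 ≤ F x := by
    intro x hx
    have hp : 0 ≤ lam ^ 2 - x ^ 2 := by nlinarith [hx.1, hx.2]
    rw [hF]; dsimp only
    nlinarith [sq_nonneg (2 * π * lam * x), norm_nonneg (g x), sq_nonneg ‖g x‖,
      mul_nonneg hp (sq_nonneg ‖deriv g x‖), mul_nonneg (sq_nonneg (2 * π * lam * x)) (sq_nonneg ‖g x‖)]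
  -- the energy identity with evenness: ∫_{-a}^{a} F = 2 Re (u(a) conj g(a))
  have hE : ∀ a, 0 ≤ a → a < lam →
      ∫ x in (-a)..a, F x = (2 * (pCoeff lam a * deriv g a * conj (g a))).re := by
    intro a ha0 ha
    have haS : a ∈ {x : ℝ | x ≠ lam ∧ x ≠ -lam} := ⟨ha.ne, by intro h; linarith⟩
    have hga : g (-a) = g a := hevenS haS
    rw [hF, energy_identity lam μ hsm hu ha0 ha, hga, hderiv_odd a haS]
    congr 1
    rw [pCoeff, pCoeff]
    push_cast
    ring
  -- the right-hand side tends to 0 as a → λ⁻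
  have hRHS : Tendsto (fun a => (2 * (pCoeff lam a * deriv g a * conj (g a))).re) (𝓝[<] lam) (𝓝 0) := by
    have hbcL : Tendsto (fun x => pCoeff lam x * deriv g x) (𝓝[<] lam) (𝓝 0) := by
      rw [← nhdsWithin_Ioo_eq_nhdsLT hlam]
      refine hbc.atLam.mono_left (nhdsWithin_mono _ fun x hx => ?_)
      exact ⟨hx.2.ne, by intro h; rw [h] at hx; linarith [hx.1]⟩
    have hconj : Tendsto (fun x => conj (g x)) (𝓝[<] lam) (𝓝 (conj cL)) :=
      (Complex.continuous_conj.tendsto cL).comp hcL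
    have h := ((hbcL.mul hconj).const_mul 2)
    rw [zero_mul, mul_zero] at h
    have h' := (Complex.continuous_re.tendsto 0).comp h
    rw [Complex.zero_re] at h'
    exact h'
  -- hence ∫_{-a}^{a} (-μ)|g|² = 0 for every a < λ
  have hint_g : ∀ a, 0 ≤ a → a < lam → IntervalIntegrable (fun x => (-μ) * ‖g x‖ ^ 2) volume (-a) a := by
    intro a ha0 ha
    have hsub : uIcc (-a) a ⊆ {x : ℝ | x ≠ lam ∧ x ≠ -lam} := by
      rw [uIcc_of_le (by linarith)]
      exact fun x hx => ⟨by intro h; rw [h] at hx; linarith [hx.2],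
        by intro h; rw [h] at hx; linarith [hx.1]⟩
    exact (continuousOn_const.mul ((hsm.continuousOn.mono hsub).norm.pow 2)).intervalIntegrable
  have hint_F : ∀ a, 0 ≤ a → a < lam → IntervalIntegrable F volume (-a) a := by
    intro a ha0 ha
    have hsub : uIcc (-a) a ⊆ {x : ℝ | x ≠ lam ∧ x ≠ -lam} := by
      rw [uIcc_of_le (by linarith)]
      exact fun x hx => ⟨by intro h; rw [h] at hx; linarith [hx.2],
        by intro h; rw [h] at hx; linarith [hx.1]⟩
    have hd1 : ContDiffOn ℝ 1 (deriv g) {x : ℝ | x ≠ lam ∧ x ≠ -lam} :=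
      hsm.deriv_of_isOpen hS (by norm_cast)
    rw [hF]
    exact (((by fun_prop : Continuous fun x : ℝ => (2 * π * lam * x) ^ 2 - μ).continuousOn.mul
      ((hsm.continuousOn.mono hsub).norm.pow 2)).add
      ((by fun_prop : Continuous fun x : ℝ => lam ^ 2 - x ^ 2).continuousOn.mul
      ((hd1.continuousOn.mono hsub).norm.pow 2))).intervalIntegrable
  have hG_le : ∀ a, 0 ≤ a → a < lam →
      ∫ x in (-a)..a, (-μ) * ‖g x‖ ^ 2 ≤ ∫ x in (-a)..a, F x := by
    intro a ha0 ha
    refine intervalIntegral.integral_mono_on (by linarith) (hint_g a ha0 ha) (hint_F a ha0 ha)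
      fun x hx => ?_
    rcases eq_or_lt_of_le ha0 with h | h
    · -- a = 0: x = 0
      have hx0 : x = 0 := by rw [← h] at hx; simpa using hx
      exact hFge x ⟨by rw [hx0]; linarith, by rw [hx0]; exact hlam⟩
    · exact hFge x ⟨by linarith [hx.1], by linarith [hx.2]⟩
  have hG_mono : ∀ a b, 0 ≤ a → a ≤ b → b < lam →
      ∫ x in (-a)..a, (-μ) * ‖g x‖ ^ 2 ≤ ∫ x in (-b)..b, (-μ) * ‖g x‖ ^ 2 := by
    intro a b ha hab hb
    have hi := hint_g b (ha.trans hab) hb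
    have hnn : ∀ x, 0 ≤ (-μ) * ‖g x‖ ^ 2 := fun x => by nlinarith [sq_nonneg ‖g x‖]
    exact intervalIntegral.integral_mono_interval (by linarith) (by linarith) (by linarith)
      (ae_of_all _ hnn) hi
  have hG_zero : ∀ a, 0 ≤ a → a < lam → ∫ x in (-a)..a, (-μ) * ‖g x‖ ^ 2 = 0 := by
    intro a ha0 ha
    have hnn : 0 ≤ ∫ x in (-a)..a, (-μ) * ‖g x‖ ^ 2 :=
      intervalIntegral.integral_nonneg (by linarith) fun x _ => by nlinarith [sq_nonneg ‖g x‖]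
    refine le_antisymm ?_ hnn
    -- G(a) ≤ G(b) ≤ ∫ F (b) → 0 as b → λ⁻
    have hev : ∀ᶠ b in 𝓝[<] lam, ∫ x in (-a)..a, (-μ) * ‖g x‖ ^ 2 ≤
        (2 * (pCoeff lam b * deriv g b * conj (g b))).re := by
      filter_upwards [Ioo_mem_nhdsLT ha] with b hb
      rw [← hE b (ha0.trans hb.1.le) hb.2]
      exact (hG_mono a b ha0 hb.1.le hb.2).trans (hG_le b (ha0.trans hb.1.le) hb.2)
    exact ge_of_tendsto hRHS hev
  -- conclusion: g = 0 on (−λ, λ)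
  refine ⟨g, hfg, hbc, hsm, fun x₀ hx₀ => ?_⟩
  by_contra hne
  have hμ0 : 0 < -μ := by linarith
  -- choose a with |x₀| < a < λ
  obtain ⟨a, ha1, ha2⟩ := exists_between (show |x₀| < lam from abs_lt.2 ⟨hx₀.1, hx₀.2⟩)
  have ha0 : 0 ≤ a := (abs_nonneg _).trans ha1.le
  have hsub : uIcc (-a) a ⊆ {x : ℝ | x ≠ lam ∧ x ≠ -lam} := by
    rw [uIcc_of_le (by linarith)]
    exact fun x hx => ⟨by intro h; rw [h] at hx; linarith [hx.2],
      by intro h; rw [h] at hx; linarith [hx.1]⟩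
  have hgc : ContinuousOn (fun x => (-μ) * ‖g x‖ ^ 2) (uIcc (-a) a) :=
    continuousOn_const.mul ((hsm.continuousOn.mono hsub).norm.pow 2)
  -- positivity near x₀
  have hx₀S : x₀ ∈ {x : ℝ | x ≠ lam ∧ x ≠ -lam} := ⟨hx₀.2.ne, by intro h; linarith [hx₀.1]⟩
  have hpos₀ : 0 < (-μ) * ‖g x₀‖ ^ 2 := mul_pos hμ0 (pow_pos (norm_pos_iff.2 hne) 2)
  have hcont₀ : ContinuousAt (fun x => (-μ) * ‖g x‖ ^ 2) x₀ :=
    (continuousAt_const.mul (((hsm.continuousOn.continuousAt (hS.mem_nhds hx₀S)).norm).pow 2))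
  obtain ⟨δ, hδ, hδpos⟩ : ∃ δ > 0, ∀ x, |x - x₀| < δ → 0 < (-μ) * ‖g x‖ ^ 2 := by
    have := hcont₀.eventually (lt_mem_nhds hpos₀)
    obtain ⟨δ, hδ, h⟩ := Metric.eventually_nhds_iff.1 this
    exact ⟨δ, hδ, fun x hx => h (by rwa [Real.dist_eq])⟩
  -- a small interval [c, d] around x₀ inside (−a, a)
  set c : ℝ := max (x₀ - δ / 2) (-a) with hc
  set d : ℝ := min (x₀ + δ / 2) a with hd
  have hx₀a : -a < x₀ ∧ x₀ < a := abs_lt.1 ha1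
  have hcd : c < d := by
    rw [hc, hd]
    exact max_lt (lt_min (by linarith) (by linarith)) (lt_min (by linarith) (by linarith))
  have hpos_cd : ∀ x ∈ Ioo c d, 0 < (-μ) * ‖g x‖ ^ 2 := by
    intro x hx
    refine hδpos x (abs_lt.2 ⟨?_, ?_⟩)
    · have : x₀ - δ / 2 ≤ c := le_max_left _ _
      linarith [hx.1]
    · have : d ≤ x₀ + δ / 2 := min_le_left _ _
      linarith [hx.2]
  have hca : -a ≤ c := le_max_right _ _
  have hda : d ≤ a := min_le_right _ _
  have hI_cd : 0 < ∫ x in c..d, (-μ) * ‖g x‖ ^ 2 :=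
    intervalIntegral_pos_of_pos_on ((hgc.mono (by
      rw [uIcc_of_le hcd.le, uIcc_of_le (by linarith)]; exact Icc_subset_Icc hca hda)).intervalIntegrable)
      hpos_cd hcd
  have hnn : ∀ x, 0 ≤ (-μ) * ‖g x‖ ^ 2 := fun x => by nlinarith [sq_nonneg ‖g x‖]
  have hle : ∫ x in c..d, (-μ) * ‖g x‖ ^ 2 ≤ ∫ x in (-a)..a, (-μ) * ‖g x‖ ^ 2 :=
    intervalIntegral.integral_mono_interval hca hcd.le hda (ae_of_all _ hnn) (hint_g a ha0 ha2)
  have := hG_zero a ha0 ha2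
  linarith

/-- **`P_λ φ = 0` for an a.e.-even eigenvector of `W_sa` with negative eigenvalue** — every `λ > 0`
(generalises seat cc-t9's `cutoffProj_eq_zero_of_hasEigenvector`, the case `λ = 1`).
[cite: ConnesMoscovici2022, Cor 2.2 (= arXiv:2112.05500 Cor 3.2, chunk p0008:L79–L84)] -/
theorem cutoffProj_eq_zero_of_hasEigenvector_of_neg (lam : ℝ) (hlam : 0 < lam) {W : L2R →ₗ.[ℂ] L2R}
    (hSA : IsProlateSA lam W) {μ : ℝ} (hμ : μ < 0) {φ : L2R} (hev : W.HasEigenvector (μ : ℂ) φ)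
    (heven : ∀ᵐ x : ℝ, (φ : ℝ → ℂ) (-x) = (φ : ℝ → ℂ) x) : cutoffProj lam φ = 0 := by
  obtain ⟨g, hfg, -, -, hzero⟩ := repr_eq_zero_on_Ioo_of_neg lam hlam hSA hμ hev heven
  refine Lp.eq_zero_iff_ae_eq_zero.2 ?_
  have hnull : ∀ᵐ x : ℝ, x ≠ lam ∧ x ≠ -lam := by
    have h1 : ∀ᵐ x : ℝ, x ≠ lam := by rw [ae_iff]; simp
    have h2 : ∀ᵐ x : ℝ, x ≠ -lam := by rw [ae_iff]; simp
    exact h1.and h2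
  filter_upwards [cutoffProj_coeFn lam φ, hfg, hnull] with x hx hfx hxS
  rw [hx, Set.indicator_apply]
  split_ifs with hmem
  · have hx' : x ∈ Ioo (-lam) lam :=
      ⟨lt_of_le_of_ne hmem.1 (fun h => hxS.2 h.symm), lt_of_le_of_ne hmem.2 hxS.1⟩
    rw [hfx, hzero x hx']
    rfl
  · rfl

end Literature.NumberTheory.ConnesMoscovici2022
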